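import Literature.AlgebraicGeometry.ShimuraVarieties.UnitaryBallClassMap
import Literature.AlgebraicGeometry.ShimuraVarieties.UnitaryBallHolomorphicTranslate
import HarnessLib

/-!
# Hecke translates of theta classes on compact ball quotient surfaces (the N33b dictionary)

Reproduction (Literature), junction of tree theorems; every declaration below is proved (no records, no
hypotheses asserted).

The seam behind "rational translates of theta ONE-FORMS are theta one-forms of another level", read on
COHOMOLOGY CLASSES through the class map data of `UnitaryBallClassMap`. Fix two compact ball quotient
surfaces `X = Γ\𝔹²`, `X' = Γ'\𝔹²` (data `D`, `D'`, Sylvester frames `𝔣`, `𝔣'`; no covering between them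
is assumed), archimedean restriction situations `ιinf : U(2,1) →* G_U` (read at `X`: level `ΓU`, `K`-type
`(Kc, κ, τ)`, corrections `hΔ`, `hη`) and `ιinf' : U(2,1) →* G_U'` (read at `X'`, primed data), spaces of
adelic forms `Θ`, `Θ'`, and `γ ∈ U(2,1)`.

* `translate_classPull_mem_holWeightForms` — a weight form of ANY level whose group function is the left
  translate `g ↦ (classPull ω)(γ g)` is HOLOMORPHIC: its ball function is the pull-back one-form
  `γ^*(lift ω) : z ↦ (Jac γ z)ᵀ · (lift ω)(γ z)` (`eq_of_toGroupFun_eq_classPull_mul_left`), holomorphic by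
  the chain rule on the ball (`BallForms.translate_mem_holomorphic`, `UnitaryBallHolomorphicTranslate`).
  (Statement and proof contributed by the period lane, unit pub-hodgecm-mc-period-1-g3.)
* `exists_mem_thetaClasses_classLift_eq_translate` — **the dictionary**: if every `F ∈ Θ` has a partner
  `F' ∈ Θ'` whose restricted group function is the LEFT `γ`-TRANSLATE `g ↦ F(ιinf (γ g))` of that of `F`,
  then every theta class `ω` of `(D, Θ)` has a theta class `ω'` of `(D', Θ')` whose holomorphic lift is
  `γ^*(lift ω)` — literally the shape of the `transl` field of the ball facts of the Picard–CM model
  (`∃ Γ' ω', ω' ∈ Θ(Γ') ∧ ev Γ' ω' = fun x ↦ J γ x *ᵥ ev Γ ω (γ • x)`). Proof: the partner's restriction is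
  holomorphic (previous item); DESCENT at `X'` (`exists_mem_hodge_F_classPull_eq`) produces `ω'`; a section
  with group function `g ↦ pull ω (γ g)` IS the pull-back form (`eq_of_toGroupFun_eq_classPull_mul_left`:
  `toGroupFun_mul_left` + injectivity of `toGroupFun` for the transitive action of `U(2,1)` on `𝔹²`).
  No holomorphy hypothesis on `Θ'` is needed.
* `exists_mem_thetaClasses_classLift_eq_translate_of_apply_eq` — one adelic group, the hypothesis on adelic
  functions: `F'(ιinf g) = F(ιinf (γ g))`.
* `exists_mem_thetaClasses_classLift_eq_of_rightTranslate` — the hypothesis moved to the finite-adelic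
  side: if `γ` is RATIONAL in the sense `ιinf γ · k ∈ ΓU` for some `k` commuting with `ιinf (U(2,1))` (its
  finite-adelic component), it suffices that `Θ'` contain, for each `F ∈ Θ`, a form `F'` with
  `F'(g) = F(g k⁻¹)` — by `WeightForms.comp_leftTranslate_eq` (`F(ιinf (γ x)) = F(ιinf x · k⁻¹)` for
  left-`ΓU`-invariant `F`).
* `exists_mem_thetaClasses_classLift_eq_of_rightTranslateHom` — the same with `F'` the tree's
  `ThetaKernelDatum.rightTranslateHom κ κ' η k⁻¹ hh hτ F` (Hecke translate moving the level,
  `Weil1964/ThetaWeightForms` §5b), so that the remaining inputs are exactly: rationality data `(k, hγk, hk)`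
  of `γ` and STABILITY `R(k⁻¹) Θ ⊆ Θ'` (for theta forms: `rightTranslateHom_thetaForm`).

References: [Borel1997, §5.13–5.14] (sections of automorphy factors ↔ functions on the group; pull-back by
`γ` ↔ left translation; §3 there for the adelic/classical dictionary), [Shimura1971, Ch. 3 §3.3] (the
action of rational elements / double cosets `Γ α Γ'` on automorphic forms of congruence subgroups — the
classical side of Hecke translation; orientation only, nothing from it is used),
[VoisinHodgeI2002, §7.1.1 Cor. 7.6] (holomorphic one-forms = `F¹H¹` on a compact Kähler surface, used
through `UnitaryBallHolomorphicLift` / `UnitaryBallClassMap`); [folklore] for the adelic bookkeeping.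
-/

noncomputable section

open Matrix MulAction Function Set
open scoped TensorProduct
open Literature.Geometry.ComplexHyperbolic
open Literature.Geometry.ComplexHyperbolic.BallModel (U21 Ball Jac x₀)
open Literature.NumberTheory.Automorphic
open Literature.NumberTheory.Automorphic.AutomorphyFactor
open Literature.AlgebraicGeometry.HodgeTheory
open Literature.AlgebraicGeometry.Motives (bettiCohomology)

namespace Literature.AlgebraicGeometry.ShimuraVarieties

namespace UnitaryBallUniformisationDatum

variable {X X' : Motives.SchemeOver ℂ} (D : UnitaryBallUniformisationDatum 2 X) (D' : UnitaryBallUniformisationDatum 2 X')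
variable (hHD : exists_isReal_hodgeModel) (𝔣 : D.SylvesterFrame) (𝔣' : D'.SylvesterFrame)
variable (hI : hodgePQ_independent_of_hodgeModel)

/-- **The left translate of `classPull ω` by `γ`, as a weight form of any level, is holomorphic**: its
ball function (through any section of the orbit map) is `γ^*(lift ω)`
(`eq_of_toGroupFun_eq_classPull_mul_left`), which is holomorphic (`BallForms.translate_mem_holomorphic`,
`classLift_mem_holomorphic`). Contributed by unit pub-hodgecm-mc-period-1-g3.
[cite: Borel1997, §5.13–5.14] -/
theorem translate_classPull_mem_holWeightForms (γ : U21) (c : ℂ ⊗[ℚ] bettiCohomology X 1)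
    {Δ' : Subgroup U21}
    {f' : weightForms Δ' (stabilizer U21 x₀).subtype
      (BallForms.isPullbackCocycle_cotangentCocycle.weightOf x₀)}
    (hf' : (f' : U21 → (Fin 2 → ℂ)) = fun g ↦ (D.classPull hHD 𝔣 c : U21 → (Fin 2 → ℂ)) (γ * g)) :
    f' ∈ BallForms.holWeightForms Δ' BallForms.isPullbackCocycle_cotangentCocycle := by
  obtain ⟨s, hs⟩ := BallForms.exists_section
  rw [BallForms.mem_holWeightForms_iff BallForms.isPullbackCocycle_cotangentCocycle hs]
  have hfun : toGroupFun BallForms.cotangentCocycle x₀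
      (((factorFormsEquiv BallForms.isPullbackCocycle_cotangentCocycle hs).symm f' :
          factorForms Δ' BallForms.cotangentCocycle) : Ball → (Fin 2 → ℂ)) =
        fun g ↦ (D.classPull hHD 𝔣 c : U21 → (Fin 2 → ℂ)) (γ * g) := by
    rw [← hf']
    exact congrArg Subtype.val
      ((factorFormsEquiv BallForms.isPullbackCocycle_cotangentCocycle hs).apply_symm_apply f')
  rw [D.eq_of_toGroupFun_eq_classPull_mul_left hHD 𝔣 c γ hfun]
  exact BallForms.translate_mem_holomorphic γ (D.classLift_mem_holomorphic hHD 𝔣 c)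

section TwoSituations

variable {GU GU' : Type*} [Group GU] [Group GU'] {Kc Kc' : Type*} [Group Kc] [Group Kc']
variable {ΓU : Subgroup GU} {ΓU' : Subgroup GU'} {κ : Kc →* GU} {κ' : Kc' →* GU'}
variable {τ : Representation ℂ Kc (Fin 2 → ℂ)} {τ' : Representation ℂ Kc' (Fin 2 → ℂ)}
variable (ιinf : U21 →* GU) (ιinf' : U21 →* GU')
  {η₁ : stabilizer U21 x₀ →* Kc} {η₁' : stabilizer U21 x₀ →* Kc'}
variable (hΔ : WeightForms.IsLevelCorrected ΓU κ τ ιinf (D.ballImage 𝔣))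
  (hη : WeightForms.IsWeightMatched κ τ ιinf (stabilizer U21 x₀).subtype
    (BallForms.isPullbackCocycle_cotangentCocycle.weightOf x₀) η₁)
  (hΔ' : WeightForms.IsLevelCorrected ΓU' κ' τ' ιinf' (D'.ballImage 𝔣'))
  (hη' : WeightForms.IsWeightMatched κ' τ' ιinf' (stabilizer U21 x₀).subtype
    (BallForms.isPullbackCocycle_cotangentCocycle.weightOf x₀) η₁')

include hI in
/-- **The N33b dictionary on classes (two adelic situations).** If every form `F ∈ Θ` has a partner
`F' ∈ Θ'` whose restricted group function is the left `γ`-translate of that of `F`, then every theta class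
`ω` of `(D, Θ)` has a theta class `ω'` of `(D', Θ')` whose holomorphic lift is the pull-back one-form
`γ^*(lift ω) : z ↦ (Jac γ z)ᵀ · (lift ω)(γ z)`. [cite: Borel1997, §5.13–5.14]
[cite: VoisinHodgeI2002, §7.1.1 Cor. 7.6] -/
theorem exists_mem_thetaClasses_classLift_eq_translate (Θ : Submodule ℂ (weightForms ΓU κ τ))
    (Θ' : Submodule ℂ (weightForms ΓU' κ' τ')) (γ : U21) {ω : ℂ ⊗[ℚ] bettiCohomology X 1}
    (hω : ω ∈ WeightForms.thetaClasses ιinf (D.classMapDatum hHD 𝔣 hI ιinf hΔ hη) Θ)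
    (hΘ : ∀ F ∈ Θ, ∃ F' ∈ Θ', (WeightForms.restrictHom ιinf' hΔ' hη' F' : U21 → Fin 2 → ℂ) =
      fun g ↦ (WeightForms.restrictHom ιinf hΔ hη F : U21 → Fin 2 → ℂ) (γ * g)) :
    ∃ ω' ∈ WeightForms.thetaClasses ιinf' (D'.classMapDatum hHD 𝔣' hI ιinf' hΔ' hη') Θ',
      D'.classLift hHD 𝔣' ω' = fun z ↦ (Jac γ z)ᵀ *ᵥ D.classLift hHD 𝔣 ω (γ • z) := by
  obtain ⟨-, F, hF, -, hpull⟩ := (D.mem_thetaClasses_iff hHD 𝔣 hI ιinf hΔ hη Θ ω).1 hω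
  obtain ⟨F', hF', hγ⟩ := hΘ F hF
  rw [← hpull] at hγ
  -- the partner's restriction is a holomorphic weight form of level `D'.ballImage 𝔣'`
  have hHol' : WeightForms.restrictHom ιinf' hΔ' hη' F' ∈
      BallForms.holWeightForms (D'.ballImage 𝔣') BallForms.isPullbackCocycle_cotangentCocycle :=
    D.translate_classPull_mem_holWeightForms hHD 𝔣 γ ω hγ
  -- descent at `X'`
  obtain ⟨ω', hω'F, hpull'⟩ := D'.exists_mem_hodge_F_classPull_eq hHD 𝔣' hI hHol'
  refine ⟨ω', (D'.mem_thetaClasses_iff hHD 𝔣' hI ιinf' hΔ' hη' Θ' ω').2 ⟨hω'F, F', hF', hHol', hpull'⟩, ?_⟩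
  -- the translate dictionary
  apply D.eq_of_toGroupFun_eq_classPull_mul_left hHD 𝔣 ω γ
  rw [← D'.coe_classPull hHD 𝔣', hpull', hγ]

end TwoSituations

section OneSituation

variable {GU : Type*} [Group GU] {Kc Kc' : Type*} [Group Kc] [Group Kc']
variable {ΓU ΓU' : Subgroup GU} {κ : Kc →* GU} {κ' : Kc' →* GU}
variable {τ : Representation ℂ Kc (Fin 2 → ℂ)} {τ' : Representation ℂ Kc' (Fin 2 → ℂ)}
variable (ιinf : U21 →* GU) {η₁ : stabilizer U21 x₀ →* Kc} {η₁' : stabilizer U21 x₀ →* Kc'}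
variable (hΔ : WeightForms.IsLevelCorrected ΓU κ τ ιinf (D.ballImage 𝔣))
  (hη : WeightForms.IsWeightMatched κ τ ιinf (stabilizer U21 x₀).subtype
    (BallForms.isPullbackCocycle_cotangentCocycle.weightOf x₀) η₁)
  (hη' : WeightForms.IsWeightMatched κ' τ' ιinf (stabilizer U21 x₀).subtype
    (BallForms.isPullbackCocycle_cotangentCocycle.weightOf x₀) η₁')

include hI in
/-- **The dictionary, one adelic group**, the hypothesis on adelic functions: every `F ∈ Θ` has a partner
`F' ∈ Θ'` with `F'(ιinf g) = F(ιinf (γ g))` for all `g ∈ U(2,1)`. [cite: Borel1997, §5.13–5.14]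
[cite: VoisinHodgeI2002, §7.1.1 Cor. 7.6] -/
theorem exists_mem_thetaClasses_classLift_eq_translate_of_apply_eq
    (hΔ' : WeightForms.IsLevelCorrected ΓU' κ' τ' ιinf (D'.ballImage 𝔣'))
    (Θ : Submodule ℂ (weightForms ΓU κ τ)) (Θ' : Submodule ℂ (weightForms ΓU' κ' τ')) (γ : U21)
    {ω : ℂ ⊗[ℚ] bettiCohomology X 1}
    (hω : ω ∈ WeightForms.thetaClasses ιinf (D.classMapDatum hHD 𝔣 hI ιinf hΔ hη) Θ)
    (hΘ : ∀ F ∈ Θ, ∃ F' ∈ Θ', ∀ g : U21,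
      (F' : GU → Fin 2 → ℂ) (ιinf g) = (F : GU → Fin 2 → ℂ) (ιinf (γ * g))) :
    ∃ ω' ∈ WeightForms.thetaClasses ιinf (D'.classMapDatum hHD 𝔣' hI ιinf hΔ' hη') Θ',
      D'.classLift hHD 𝔣' ω' = fun z ↦ (Jac γ z)ᵀ *ᵥ D.classLift hHD 𝔣 ω (γ • z) :=
  D.exists_mem_thetaClasses_classLift_eq_translate D' hHD 𝔣 𝔣' hI ιinf ιinf hΔ hη hΔ' hη' Θ Θ' γ hω
    fun F hF ↦ by
      obtain ⟨F', hF', h⟩ := hΘ F hF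
      exact ⟨F', hF', funext fun g ↦ by
        rw [WeightForms.restrictHom_apply, WeightForms.restrictHom_apply, h g]⟩

include hI in
/-- **The dictionary, hypothesis on the finite-adelic side.** For `γ` RATIONAL (`ιinf γ · k ∈ ΓU` with
`k` commuting with `ιinf (U(2,1))`): if for every `F ∈ Θ` the space `Θ'` contains a form `F'` with
`F'(g) = F(g k⁻¹)`, then every theta class of `(D, Θ)` has a theta class of `(D', Θ')` lifting to the
pull-back form by `γ` (`WeightForms.comp_leftTranslate_eq`: a rational left translate downstairs is a
finite-adelic right translate upstairs). [cite: Borel1997, §5.13–5.14] [folklore] -/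
theorem exists_mem_thetaClasses_classLift_eq_of_rightTranslate
    (hΔ' : WeightForms.IsLevelCorrected ΓU' κ' τ' ιinf (D'.ballImage 𝔣'))
    (Θ : Submodule ℂ (weightForms ΓU κ τ)) (Θ' : Submodule ℂ (weightForms ΓU' κ' τ'))
    {γ : U21} {k : GU} (hγk : ιinf γ * k ∈ ΓU) (hk : ∀ x : U21, Commute k (ιinf x))
    {ω : ℂ ⊗[ℚ] bettiCohomology X 1}
    (hω : ω ∈ WeightForms.thetaClasses ιinf (D.classMapDatum hHD 𝔣 hI ιinf hΔ hη) Θ)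
    (hΘ : ∀ F ∈ Θ, ∃ F' ∈ Θ', ∀ g : GU, (F' : GU → Fin 2 → ℂ) g = (F : GU → Fin 2 → ℂ) (g * k⁻¹)) :
    ∃ ω' ∈ WeightForms.thetaClasses ιinf (D'.classMapDatum hHD 𝔣' hI ιinf hΔ' hη') Θ',
      D'.classLift hHD 𝔣' ω' = fun z ↦ (Jac γ z)ᵀ *ᵥ D.classLift hHD 𝔣 ω (γ • z) :=
  D.exists_mem_thetaClasses_classLift_eq_translate_of_apply_eq D' hHD 𝔣 𝔣' hI ιinf hΔ hη hη' hΔ' Θ Θ' γ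
    hω fun F hF ↦ by
      obtain ⟨F', hF', hk'⟩ := hΘ F hF
      exact ⟨F', hF', fun g ↦ by
        rw [hk', WeightForms.comp_leftTranslate_eq_of_mem ιinf F.2 hγk hk g]⟩

include hI in
/-- **The dictionary, Hecke-translate version.** With `F' := R(k⁻¹) F` the tree's level-moving right
translate `ThetaKernelDatum.rightTranslateHom κ κ' η k⁻¹ hh hτ F` (`Weil1964/ThetaWeightForms` §5b), the
remaining inputs are: rationality data of `γ` and STABILITY `R(k⁻¹) Θ ⊆ Θ'` (for theta forms this is
`rightTranslateHom_thetaForm`). [cite: Borel1997, §5.13–5.14] [folklore] -/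
theorem exists_mem_thetaClasses_classLift_eq_of_rightTranslateHom
    (Θ : Submodule ℂ (weightForms ΓU κ τ)) (Θ' : Submodule ℂ (weightForms ΓU κ' τ')) {η : Kc' →* Kc}
    (hΔ' : WeightForms.IsLevelCorrected ΓU κ' τ' ιinf (D'.ballImage 𝔣'))
    {γ : U21} {k : GU} (hγk : ιinf γ * k ∈ ΓU) (hk : ∀ x : U21, Commute k (ιinf x))
    (hh : ∀ k' : Kc', κ' k' * k⁻¹ = k⁻¹ * κ (η k')) (hτ : ∀ k' : Kc', τ' k' = τ (η k'))
    {ω : ℂ ⊗[ℚ] bettiCohomology X 1}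
    (hω : ω ∈ WeightForms.thetaClasses ιinf (D.classMapDatum hHD 𝔣 hI ιinf hΔ hη) Θ)
    (hΘ : ∀ F ∈ Θ, NumberTheory.Weil1964.ThetaKernelDatum.rightTranslateHom κ κ' η k⁻¹ hh hτ F ∈ Θ') :
    ∃ ω' ∈ WeightForms.thetaClasses ιinf (D'.classMapDatum hHD 𝔣' hI ιinf hΔ' hη') Θ',
      D'.classLift hHD 𝔣' ω' = fun z ↦ (Jac γ z)ᵀ *ᵥ D.classLift hHD 𝔣 ω (γ • z) :=
  D.exists_mem_thetaClasses_classLift_eq_of_rightTranslate D' hHD 𝔣 𝔣' hI ιinf hΔ hη hη' hΔ' Θ Θ' hγk hk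
    hω fun F hF ↦ ⟨_, hΘ F hF, fun _ ↦ rfl⟩

end OneSituation

end UnitaryBallUniformisationDatum

end Literature.AlgebraicGeometry.ShimuraVarieties

end
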